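import Summits.KontsevichZagierPeriods.KontsevichZagierPeriods.Theorems.SymplecticScissorsRealOnePeriodRelationsStubFormReductionPAux

/-!
# Crux `RealOnePeriodRelations` (stmt-KontsevichZagierPeriods-10042), line `nash-retraction-thin-strip`, reshape 10:
# de Rham reduction on `C_T` (stub `stub_formReductionP`), II: reducible forms and the pull-back from `E_L`

Second of five files proving `stub_formReductionP`.  `FRed[L, T] ω` (local notation for the conclusion of the
stub) is stable under sums, algebraic scalars, exact and vanishing summands and congruence on `C_T`; it holds for
`θ₀^C, θ₁^C, dx/(x − t), ξ_t`.  The chain rule `f^* dP = d(P ∘ f)` (`formPullback_formD`) and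
`ι^*(ν) = 0` on `C_T` for `ν = 0` on `E_L` transport `Weier.exists_reduction` along `ι = (x, y)`:
`ι^*ω₂` is reducible for every two-variable form over `ℚ̄` (`fred_formPullback_iota`), in particular `xⁿ θ₀^C`,
`(x − a) θ₀^C` and `xⁿ dx`.
[cite: HuberWustholz2022, §3.3.1, §13.2]
-/

noncomputable section

open scoped BigOperators Topology PeriodPair
open Set Filter MvPolynomial Complex
open Literature.NumberTheory.Transcendental Literature.NumberTheory.Transcendental.CurvePeriods
open Literature.NumberTheory.Transcendental.CurvePeriods.Ell

namespace Summit.KontsevichZagierPeriods.SymplecticScissors.RealOnePeriodRelations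

namespace TorsionLayer

variable (L : PeriodPair) (T : Finset ℂ)

set_option quotPrecheck false in
/-- `FRed[L, T] ω`: the polynomial 1-form `ω` on `C_T` is `a θ₀ + b θ₁ + Σ e_t dx/(x − t) + Σ o_t ξ_t + dF + ν`
with algebraic data and `ν` over `ℚ̄` vanishing on `C_T` (the conclusion of `stub_formReductionP`). -/
local notation3 (prettyPrint := false) "FRed[" L' ", " T' "] " ω:arg =>
  (∃ (a b : ℂ) (e o : ℂ → ℂ) (F : MvPolynomial (Fin 3) ℂ) (ν : Fin 3 → MvPolynomial (Fin 3) ℂ),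
    IsAlgebraic ℚ a ∧ IsAlgebraic ℚ b ∧ (∀ t ∈ T', IsAlgebraic ℚ (e t)) ∧ (∀ t ∈ T', IsAlgebraic ℚ (o t)) ∧
    HasAlgCoeffs F ∧ (∀ i, HasAlgCoeffs (ν i)) ∧ VanishesOn (curveP L' T') ν ∧
    ω = a • Theta0 L' + b • Theta1 L' + ∑ t ∈ T', e t • dlogV T' t + ∑ t ∈ T', o t • Xi L' T' t + formD F + ν)

variable {L T}

/-- Vanishing forms are reducible. [folklore] -/
theorem fred_vanish {ν : Fin 3 → MvPolynomial (Fin 3) ℂ} (hν : ∀ i, HasAlgCoeffs (ν i))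
    (hv : VanishesOn (curveP L T) ν) : FRed[L, T] ν :=
  ⟨0, 0, 0, 0, 0, ν, isAlgebraic_zero, isAlgebraic_zero, fun _ _ => by simpa using isAlgebraic_zero,
    fun _ _ => by simpa using isAlgebraic_zero, hasAlgCoeffs_zero, hν, hv, by simp [formD_zero]⟩

/-- The zero form is reducible. [folklore] -/
theorem fred_zero : FRed[L, T] 0 :=
  fred_vanish (fun _ => by simpa using (hasAlgCoeffs_zero (n := 3))) (VanishesOn.zero _)

/-- Exact forms are reducible. [folklore] -/
theorem fred_formD {F : MvPolynomial (Fin 3) ℂ} (hF : HasAlgCoeffs F) : FRed[L, T] (formD F) :=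
  ⟨0, 0, 0, 0, F, 0, isAlgebraic_zero, isAlgebraic_zero, fun _ _ => by simpa using isAlgebraic_zero,
    fun _ _ => by simpa using isAlgebraic_zero, hF, fun _ => by simpa using (hasAlgCoeffs_zero (n := 3)),
    VanishesOn.zero _, by simp⟩

/-- `θ₀^C` is reducible. [folklore] -/
theorem fred_Theta0 : FRed[L, T] (Theta0 L) :=
  ⟨1, 0, 0, 0, 0, 0, isAlgebraic_one, isAlgebraic_zero, fun _ _ => by simpa using isAlgebraic_zero,
    fun _ _ => by simpa using isAlgebraic_zero, hasAlgCoeffs_zero, fun _ => by simpa using (hasAlgCoeffs_zero (n := 3)),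
    VanishesOn.zero _, by simp [formD_zero]⟩

/-- `θ₁^C` is reducible. [folklore] -/
theorem fred_Theta1 : FRed[L, T] (Theta1 L) :=
  ⟨0, 1, 0, 0, 0, 0, isAlgebraic_zero, isAlgebraic_one, fun _ _ => by simpa using isAlgebraic_zero,
    fun _ _ => by simpa using isAlgebraic_zero, hasAlgCoeffs_zero, fun _ => by simpa using (hasAlgCoeffs_zero (n := 3)),
    VanishesOn.zero _, by simp [formD_zero]⟩

/-- `dx/(x − t)` is reducible (`t ∈ T`). [folklore] -/
theorem fred_dlogV {t : ℂ} (ht : t ∈ T) : FRed[L, T] (dlogV T t) := by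
  classical
  refine ⟨0, 0, fun s => if s = t then 1 else 0, 0, 0, 0, isAlgebraic_zero, isAlgebraic_zero,
    fun s _ => ?_, fun _ _ => by simpa using isAlgebraic_zero, hasAlgCoeffs_zero,
    fun _ => by simpa using (hasAlgCoeffs_zero (n := 3)), VanishesOn.zero _, ?_⟩
  · dsimp only
    split_ifs
    · exact isAlgebraic_one
    · exact isAlgebraic_zero
  · simp [formD_zero, ite_smul, Finset.sum_ite_eq', ht]

/-- `ξ_t` is reducible (`t ∈ T`). [folklore] -/
theorem fred_Xi {t : ℂ} (ht : t ∈ T) : FRed[L, T] (Xi L T t) := by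
  classical
  refine ⟨0, 0, 0, fun s => if s = t then 1 else 0, 0, 0, isAlgebraic_zero, isAlgebraic_zero,
    fun _ _ => by simpa using isAlgebraic_zero, fun s _ => ?_, hasAlgCoeffs_zero,
    fun _ => by simpa using (hasAlgCoeffs_zero (n := 3)), VanishesOn.zero _, ?_⟩
  · dsimp only
    split_ifs
    · exact isAlgebraic_one
    · exact isAlgebraic_zero
  · simp [formD_zero, ite_smul, Finset.sum_ite_eq', ht]

/-- Reducible forms are stable under sums. [folklore] -/
theorem fred_add {ω₁ ω₂ : Fin 3 → MvPolynomial (Fin 3) ℂ} (h₁ : FRed[L, T] ω₁) (h₂ : FRed[L, T] ω₂) :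
    FRed[L, T] (ω₁ + ω₂) := by
  obtain ⟨a₁, b₁, e₁, o₁, F₁, ν₁, ha₁, hb₁, he₁, ho₁, hF₁, hν₁, hv₁, h₁⟩ := h₁
  obtain ⟨a₂, b₂, e₂, o₂, F₂, ν₂, ha₂, hb₂, he₂, ho₂, hF₂, hν₂, hv₂, h₂⟩ := h₂
  refine ⟨a₁ + a₂, b₁ + b₂, e₁ + e₂, o₁ + o₂, F₁ + F₂, ν₁ + ν₂, ha₁.add ha₂, hb₁.add hb₂,
    fun t ht => (he₁ t ht).add (he₂ t ht), fun t ht => (ho₁ t ht).add (ho₂ t ht), hF₁.add hF₂,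
    fun i => (hν₁ i).add (hν₂ i), hv₁.add hv₂, ?_⟩
  rw [h₁, h₂, formD_add]
  simp only [Pi.add_apply, add_smul, Finset.sum_add_distrib]
  abel

/-- Reducible forms are stable under algebraic scalars. [folklore] -/
theorem fred_smul {ω : Fin 3 → MvPolynomial (Fin 3) ℂ} {c : ℂ} (hc : IsAlgebraic ℚ c) (h : FRed[L, T] ω) :
    FRed[L, T] (c • ω) := by
  obtain ⟨a, b, e, o, F, ν, ha, hb, he, ho, hF, hν, hv, hω⟩ := h
  refine ⟨c * a, c * b, fun t => c * e t, fun t => c * o t, C c * F, c • ν, hc.mul ha, hc.mul hb,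
    fun t ht => hc.mul (he t ht), fun t ht => hc.mul (ho t ht), (hasAlgCoeffs_C hc).mul hF,
    fun i => (hν i).smul hc, hv.smul c, ?_⟩
  rw [hω, formD_C_mul]
  simp only [smul_add, smul_smul, Finset.smul_sum]

/-- Reducible forms are stable under negation. [folklore] -/
theorem fred_neg {ω : Fin 3 → MvPolynomial (Fin 3) ℂ} (h : FRed[L, T] ω) : FRed[L, T] (-ω) := by
  simpa using fred_smul (isAlgebraic_one.neg) h

/-- Reducible forms are stable under differences. [folklore] -/
theorem fred_sub {ω₁ ω₂ : Fin 3 → MvPolynomial (Fin 3) ℂ} (h₁ : FRed[L, T] ω₁) (h₂ : FRed[L, T] ω₂) :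
    FRed[L, T] (ω₁ - ω₂) := by
  simpa [sub_eq_add_neg] using fred_add h₁ (fred_neg h₂)

/-- Undo an algebraic nonzero scalar. [folklore] -/
theorem fred_of_smul {ω : Fin 3 → MvPolynomial (Fin 3) ℂ} {c : ℂ} (hc : IsAlgebraic ℚ c) (hc0 : c ≠ 0)
    (h : FRed[L, T] (c • ω)) : FRed[L, T] ω := by
  have h' := fred_smul hc.inv h
  rwa [smul_smul, inv_mul_cancel₀ hc0, one_smul] at h'

/-- Reducibility only depends on the form on `C_T`. [folklore] -/
theorem fred_congr {ω ω' : Fin 3 → MvPolynomial (Fin 3) ℂ} (hω : ∀ i, HasAlgCoeffs (ω i))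
    (hω' : ∀ i, HasAlgCoeffs (ω' i)) (hd : VanishesOn (curveP L T) (ω - ω')) (h : FRed[L, T] ω') :
    FRed[L, T] ω := by
  obtain ⟨a, b, e, o, F, ν, ha, hb, he, ho, hF, hν, hv, he'⟩ := h
  refine ⟨a, b, e, o, F, ν + (ω - ω'), ha, hb, he, ho, hF, fun i => (hν i).add ((hω i).sub (hω' i)),
    hv.add hd, ?_⟩
  rw [← add_assoc, ← he']
  abel

/-- Reducible forms are stable under finite sums. [folklore] -/
theorem fred_sum {ι : Type*} (S : Finset ι) (ω : ι → Fin 3 → MvPolynomial (Fin 3) ℂ)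
    (h : ∀ i ∈ S, FRed[L, T] (ω i)) : FRed[L, T] (∑ i ∈ S, ω i) := by
  classical
  induction S using Finset.induction_on with
  | empty => simpa using fred_zero (L := L) (T := T)
  | insert j S hj ih =>
    rw [Finset.sum_insert hj]
    exact fred_add (h j (Finset.mem_insert_self j S)) (ih fun i hi => h i (Finset.mem_insert_of_mem hi))

/-- `P θ₀^C` is reducible as soon as `P′ θ₀^C` is and `P = P′` on `C_T` (`P, P′` over `ℚ̄`). [folklore] -/
theorem fred_smul_Theta0_congr (h₂ : IsAlgebraic ℚ L.g₂) (h₃ : IsAlgebraic ℚ L.g₃) {P P' : MvPolynomial (Fin 3) ℂ}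
    (hP : HasAlgCoeffs P) (hP' : HasAlgCoeffs P') (heq : ∀ p ∈ (curveP L T).points, eval p P = eval p P')
    (h : FRed[L, T] (P' • Theta0 L)) : FRed[L, T] (P • Theta0 L) := by
  refine fred_congr (hasAlgCoeffs_smul_form hP (hasAlgCoeffs_Theta0 L h₂ h₃))
    (hasAlgCoeffs_smul_form hP' (hasAlgCoeffs_Theta0 L h₂ h₃)) ?_ h
  rw [← sub_smul]
  exact vanishesOn_smul_Theta0 L T fun p hp => by simp [heq p hp]

/-- `P dx` is reducible as soon as `P′ dx` is and `P = P′` on `C_T` (`P, P′` over `ℚ̄`). [folklore] -/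
theorem fred_dx_congr {P P' : MvPolynomial (Fin 3) ℂ} (hP : HasAlgCoeffs P) (hP' : HasAlgCoeffs P')
    (heq : ∀ p ∈ (curveP L T).points, eval p P = eval p P')
    (h : FRed[L, T] (![P', 0, 0] : Fin 3 → MvPolynomial (Fin 3) ℂ)) :
    FRed[L, T] (![P, 0, 0] : Fin 3 → MvPolynomial (Fin 3) ℂ) := by
  refine fred_congr (hasAlgCoeffs_vec3 hP hasAlgCoeffs_zero hasAlgCoeffs_zero)
    (hasAlgCoeffs_vec3 hP' hasAlgCoeffs_zero hasAlgCoeffs_zero) ?_ h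
  have e : ((![P, 0, 0] : Fin 3 → MvPolynomial (Fin 3) ℂ) - ![P', 0, 0]) = ![P - P', 0, 0] := by
    funext k
    fin_cases k <;> simp
  rw [e]
  exact vanishesOn_dx L T fun p hp => by simp [heq p hp]

/-! ## Pulling back the reduction on `E_L` along `ι = (x, y)` -/

/-- [folklore] -/
theorem formPullback_add' {n n' : ℕ} (f : Fin n' → MvPolynomial (Fin n) ℂ)
    (ω₁ ω₂ : Fin n' → MvPolynomial (Fin n') ℂ) :
    formPullback f (ω₁ + ω₂) = formPullback f ω₁ + formPullback f ω₂ := by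
  funext i
  simp [formPullback, Finset.sum_add_distrib, add_mul]

/-- [folklore] -/
theorem formPullback_smul' {n n' : ℕ} (f : Fin n' → MvPolynomial (Fin n) ℂ) (c : ℂ)
    (ω : Fin n' → MvPolynomial (Fin n') ℂ) : formPullback f (c • ω) = c • formPullback f ω := by
  funext i
  simp [formPullback, Finset.smul_sum, smul_eq_C_mul, mul_assoc]

/-- [folklore] -/
theorem formPullback_polysmul {n n' : ℕ} (f : Fin n' → MvPolynomial (Fin n) ℂ) (P : MvPolynomial (Fin n') ℂ)
    (ω : Fin n' → MvPolynomial (Fin n') ℂ) : formPullback f (P • ω) = bind₁ f P • formPullback f ω := by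
  funext i
  simp [formPullback, Finset.mul_sum, mul_assoc]

/-- **`f^* dP = d(P ∘ f)`** for polynomial maps (the chain rule). [folklore] -/
theorem formPullback_formD {n n' : ℕ} (f : Fin n' → MvPolynomial (Fin n) ℂ) (P : MvPolynomial (Fin n') ℂ) :
    formPullback f (formD P) = formD (bind₁ f P) := by
  induction P using MvPolynomial.induction_on with
  | C a =>
    funext i
    simp [formPullback, formD]
  | add p q hp hq => rw [formD_add, formPullback_add', hp, hq, map_add, formD_add]
  | mul_X p j hp =>
    funext i
    have h := congrFun hp i
    simp only [formPullback, formD] at h ⊢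
    have key : ∀ k, bind₁ f (pderiv k (p * X j)) * pderiv i (f k) =
        bind₁ f (pderiv k p) * pderiv i (f k) * f j + (if k = j then bind₁ f p * pderiv i (f j) else 0) := by
      intro k
      rw [pderiv_mul]
      by_cases hk : k = j
      · subst hk
        rw [pderiv_X_self, if_pos rfl, map_add, map_mul, map_mul, bind₁_X_right, map_one]
        ring
      · rw [pderiv_X_of_ne (fun h => hk h.symm), if_neg hk, mul_zero, add_zero, map_mul, bind₁_X_right]
        ring
    rw [Finset.sum_congr rfl fun k _ => key k, Finset.sum_add_distrib, Finset.sum_ite_eq' Finset.univ j,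
      if_pos (Finset.mem_univ _), ← Finset.sum_mul, h, map_mul, bind₁_X_right, pderiv_mul]

/-- `ι^*` of a two-variable form. [folklore] -/
theorem formPullback_iota_vec2 (G H : MvPolynomial (Fin 2) ℂ) :
    formPullback iota ![G, H] = ![bind₁ iota G, bind₁ iota H, 0] := by
  funext i
  fin_cases i <;> simp [formPullback, iota, Fin.sum_univ_two, pderiv_X]

/-- **`ι^*` of a form vanishing on `E_L` vanishes on `C_T`** (`ι` maps `C_T` into `E_L`, tangent lines into
tangent lines). [folklore] -/
theorem vanishesOn_formPullback_iota {ν : Fin 2 → MvPolynomial (Fin 2) ℂ} (hν : VanishesOn (curve L) ν) :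
    VanishesOn (curveP L T) (formPullback iota ν) := by
  intro p hp t ht
  rw [formPullback_pair, iota_eval]
  rw [Finset.sum_congr rfl fun j _ => by rw [sum_pderiv_iota]]
  have hz : (![p 0, p 1] : Fin 2 → ℂ) ∈ (curve L).points := by
    have h := iota_mapsTo_P L T p hp
    rwa [iota_eval] at h
  refine hν _ hz _ ?_
  rw [Weier.mem_tangentSpace_iff, Weier.eval_pderiv_zero_fPoly]
  have h1 := ((mem_tangentSpace_curveP_iff L T p t).1 ht).1
  simpa using h1

/-- **Pull-back of the reduction on `E_L`**: `ι^*ω₂` is reducible for every two-variable form `ω₂` over `ℚ̄`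
(`Weier.exists_reduction`: `ω₂ = a θ₀ + b θ₁ + dP + ν` on `E_L`; `ι^* dP = d(P ∘ ι)`). [cite: HuberWustholz2022, §13.2] -/
theorem fred_formPullback_iota : ∀ (L : PeriodPair) (T : Finset ℂ), IsAlgebraic ℚ L.g₂ → IsAlgebraic ℚ L.g₃ → ∀ (ω₂ : Fin 2 → MvPolynomial (Fin 2) ℂ), (∀ k, HasAlgCoeffs (ω₂ k)) → ∃ (a b : ℂ) (e o : ℂ → ℂ) (F : MvPolynomial (Fin 3) ℂ) (ν : Fin 3 → MvPolynomial (Fin 3) ℂ), IsAlgebraic ℚ a ∧ IsAlgebraic ℚ b ∧ (∀ t ∈ T, IsAlgebraic ℚ (e t)) ∧ (∀ t ∈ T, IsAlgebraic ℚ (o t)) ∧ HasAlgCoeffs F ∧ (∀ i, HasAlgCoeffs (ν i)) ∧ VanishesOn (curveP L T) ν ∧ formPullback iota ω₂ = a • Theta0 L + b • Theta1 L + ∑ t ∈ T, e t • dlogV T t + ∑ t ∈ T, o t • Xi L T t + formD F + ν := by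
  intro L T h₂ h₃ ω₂ hω₂
  obtain ⟨a, b, P, ν, ha, hb, hP, hν, hv, he⟩ := Weier.exists_reduction (A L) (B L) (isAlgebraic_A L h₂)
    (isAlgebraic_B L h₃) (disc_ne_zero L) ω₂ hω₂
  rw [he, formPullback_add', formPullback_add', formPullback_add', formPullback_smul', formPullback_smul',
    formPullback_formD]
  exact fred_add (fred_add (fred_add (fred_smul ha fred_Theta0) (fred_smul hb fred_Theta1))
    (fred_formD (hP.bind₁ hasAlgCoeffs_iota)))
    (fred_vanish (HasAlgCoeffs.formPullback hasAlgCoeffs_iota hν) (vanishesOn_formPullback_iota hv))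

/-- `p(x, y) θ₀^C` is reducible for `p ∈ ℚ̄[x, y]`. [folklore] -/
theorem fred_bind₁_smul_Theta0 (h₂ : IsAlgebraic ℚ L.g₂) (h₃ : IsAlgebraic ℚ L.g₃) {P : MvPolynomial (Fin 2) ℂ}
    (hP : HasAlgCoeffs P) : FRed[L, T] (bind₁ iota P • Theta0 L) := by
  have h := fred_formPullback_iota L T h₂ h₃ _
    (Weier.hasAlgCoeffs_smul_theta0 (A L) (B L) (isAlgebraic_A L h₂) (isAlgebraic_B L h₃) hP)
  rwa [formPullback_polysmul] at h

/-- `xⁿ θ₀^C` is reducible. [folklore] -/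
theorem fred_X_pow_smul_Theta0 (h₂ : IsAlgebraic ℚ L.g₂) (h₃ : IsAlgebraic ℚ L.g₃) (n : ℕ) :
    FRed[L, T] ((X 0 ^ n : MvPolynomial (Fin 3) ℂ) • Theta0 L) := by
  have h := fred_bind₁_smul_Theta0 (T := T) h₂ h₃ ((hasAlgCoeffs_X (n := 2) 0).pow n)
  rwa [map_pow, bind₁_X_right] at h

/-- `(x − a) θ₀^C` is reducible for algebraic `a`. [folklore] -/
theorem fred_X_sub_C_smul_Theta0 (h₂ : IsAlgebraic ℚ L.g₂) (h₃ : IsAlgebraic ℚ L.g₃) {a : ℂ} (ha : IsAlgebraic ℚ a) :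
    FRed[L, T] ((X 0 - C a : MvPolynomial (Fin 3) ℂ) • Theta0 L) := by
  have h := fred_bind₁_smul_Theta0 (T := T) h₂ h₃ ((hasAlgCoeffs_X (n := 2) 0).sub (hasAlgCoeffs_C ha))
  rwa [map_sub, bind₁_X_right, bind₁_C_right] at h

/-- `xⁿ dx` is reducible (exact). [folklore] -/
theorem fred_X_pow_dx (h₂ : IsAlgebraic ℚ L.g₂) (h₃ : IsAlgebraic ℚ L.g₃) (n : ℕ) :
    FRed[L, T] (![X 0 ^ n, 0, 0] : Fin 3 → MvPolynomial (Fin 3) ℂ) := by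
  have halg : ∀ k, HasAlgCoeffs ((![X 0 ^ n, 0] : Fin 2 → MvPolynomial (Fin 2) ℂ) k) := by
    intro k
    fin_cases k
    · simpa using (hasAlgCoeffs_X (n := 2) 0).pow n
    · simpa using (hasAlgCoeffs_zero (n := 2))
  have h := fred_formPullback_iota L T h₂ h₃ _ halg
  rwa [formPullback_iota_vec2, map_pow, bind₁_X_right, map_zero] at h


end TorsionLayer

end Summit.KontsevichZagierPeriods.SymplecticScissors.RealOnePeriodRelations

end
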